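import Summits.QuantumFields.YangMills.Theorems.BalabanLadderUVSeamRecPolymerCarrierFolding
import HarnessLib

/-!
# Crux `UVSeamRec` (stmt-QuantumFields-20043), v5(α) stub `stub_responseMomentsOdd6` (RM): the PERIOD-FREE LEVEL-`0` PRODUCT LAW on every odd
# torus for the fundamental Wilson state of `SU(N)` — the proved bottom level of the per-level large-field input

Helper file (`--supports stmt-QuantumFields-20043`) of the width-lever seat `ym-20043-ceilings-p2` (lane B, gen 3); reads ceilings-p2 g0's Peierls gas
of large plaquettes (p530009 `PolymerRarity.productLaw_largePlaquettes`, Fröhlich–Israel–Lieb–Simon chessboard at the plaquette scale on every odd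
torus) through tempered-d1's level-`0` dictionary (p542905 `torusLift_mem_largeFieldEvent_zero_iff_cost`, `anchor_zero`) in the PERIOD-FREE shape
that this seat's levelwise composition (p550081 `torusE_exp_two_mul_sum_influence_le_of_levelwise`) consumes at level `0`:
`torusE_prod_indicator_levelZero_le` — for `L ≥ 1`, `β ≥ 1` and every period-free finite family `A` of level-`0` block-plaquettes of `ℤ⁴`,
`⟨∏_{γ∈A} 1_{largeFieldEvent 𝔟 ε₀ γ}∘lift⟩_{2L+1,β} ≤ ∏_{γ∈A} exp(−βNε₀/#Orient + (K₀ + D₁ log β)/#Orient)` (`#Orient = 6`); period-free at level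
`0` means the projected torus plaquettes are distinct.  (tempered-d1's `…PolymerCarrierLevelZero` p544404 proves the level-`0` MOMENT bound by
folding onto box representatives; this is the product-law form, by period classes.)  HONEST FRAMING: one proved rung; nothing of E0′; not a gap,
not Clay.
References: J. Fröhlich, R. Israel, E. H. Lieb, B. Simon, Commun. Math. Phys. 62 (1978) §5 (via p530009); folklore.
-/

set_option autoImplicit false

noncomputable section

open MeasureTheory Filter Topology Finset
open Literature.Probability.LatticeModels
open Literature.MathematicalPhysics.QuantumFieldTheory (GaugeConfig wilsonMeasure isProbabilityMeasure_wilsonMeasure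
  measurable_torusLift LatticeRep plaquetteCost measurable_plaquetteCost Plaquette)
open Literature.MathematicalPhysics.QuantumLattice

namespace Summit.QuantumFields.YangMills.Cruxes.UVSeamRec.TemperedResponse

open Summit.QuantumFields.YangMills.Cruxes.OSLegsFromFemtoAndGap.DlrCollarTransfer
open Summit.QuantumFields.YangMills.Cruxes.UVSeamRec.PolymerData
open Summit.QuantumFields.YangMills.Cruxes.UVSeamRec.PolymerRarity (productLaw_largePlaquettes)
open Summit.QuantumFields.YangMills.Cruxes.UVSeamRec.DefectCollar (integral_prod_indicator_eq_measureReal)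
open Summit.QuantumFields.YangMills.Theorems.OddTorusChessboard (Orient)

/-! ## §1 The period-free level-`0` product law on every odd torus (fundamental Wilson state of `SU(N)`) -/

section LevelZero

variable {N : ℕ} [NeZero N]

/-- A level-`0` block-plaquette read on the periodic lift is the large-PLAQUETTE event of the projected torus plaquette (tempered-d1's
`torusLift_mem_largeFieldEvent_zero_iff_cost`, as an identity of indicators). [folklore] -/
theorem indicator_largeFieldEvent_levelZero_torusLift (𝔟 : BlockSize) (e : ℝ) (L : ℕ) {γ : Polymer} (hk : γ.k = 0)
    (U : GaugeConfig 4 (2 * L + 1) (Matrix.specialUnitaryGroup (Fin N) ℂ)) :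
    (largeFieldEvent (N := N) 𝔟 e γ).indicator (fun _ => (1 : ℝ)) (torusLift (2 * L + 1) U) =
      {V : GaugeConfig 4 (2 * L + 1) (Matrix.specialUnitaryGroup (Fin N) ℂ) |
          (N : ℝ) * e ≤ plaquetteCost (fundamentalLatticeRep N).ρ V
            (Torus.proj (2 * L + 1) γ.y, ⟨(γ.μ, γ.ν), γ.hμν⟩)}.indicator (fun _ => (1 : ℝ)) U := by
  obtain ⟨k, y, μ, ν, h⟩ := γ
  simp only at hk
  subst hk
  show _ = {V : GaugeConfig 4 (2 * L + 1) (Matrix.specialUnitaryGroup (Fin N) ℂ) |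
      (N : ℝ) * e ≤ plaquetteCost (fundamentalLatticeRep N).ρ V (Torus.proj (2 * L + 1) y, ⟨(μ, ν), h⟩)}.indicator
    (fun _ => (1 : ℝ)) U
  have hiff := torusLift_mem_largeFieldEvent_zero_iff_cost (N := N) 𝔟 e y μ ν h L U
  have hmem : U ∈ {V : GaugeConfig 4 (2 * L + 1) (Matrix.specialUnitaryGroup (Fin N) ℂ) |
      (N : ℝ) * e ≤ plaquetteCost (fundamentalLatticeRep N).ρ V (Torus.proj (2 * L + 1) y, ⟨(μ, ν), h⟩)} ↔
      (N : ℝ) * e ≤ plaquetteCost (fundamentalLatticeRep N).ρ U (Torus.proj (2 * L + 1) y, ⟨(μ, ν), h⟩) := Iff.rfl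
  classical
  by_cases hU : torusLift (2 * L + 1) U ∈ largeFieldEvent (N := N) 𝔟 e ⟨0, y, μ, ν, h⟩
  · rw [Set.indicator_of_mem hU, Set.indicator_of_mem (hmem.2 (hiff.1 hU))]
  · rw [Set.indicator_of_notMem hU, Set.indicator_of_notMem (fun h' => hU (hiff.2 (hmem.1 h')))]

/-- **THE PERIOD-FREE LEVEL-`0` PRODUCT LAW ON EVERY ODD TORUS.**  For the fundamental Wilson state of `SU(N)` there are constants `K₀, D₁`
(ceilings-p2 g0's p530009) such that for every block size `𝔟`, threshold `ε₀`, `L ≥ 1`, `β ≥ 1` and every PERIOD-FREE finite family `A` of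
level-`0` block-plaquettes of `ℤ⁴`: `⟨∏_{γ∈A} 1_{largeFieldEvent 𝔟 ε₀ γ}∘lift⟩_{2L+1,β} ≤ ∏_{γ∈A} exp(−βNε₀/#Orient + (K₀ + D₁ log β)/#Orient)`
(`#Orient = 6`).  Period-free at level `0` means the projected torus plaquettes are distinct, so this is p530009's Peierls gas read through
tempered-d1's level-`0` dictionary. [folklore: Fröhlich–Israel–Lieb–Simon (1978) §5 for the input] -/
theorem torusE_prod_indicator_levelZero_le :
    ∃ K₀ : ℝ, ∃ D₁ : ℕ, ∀ (𝔟 : BlockSize) (ε₀ : ℝ) (L : ℕ), 1 ≤ L → ∀ β : ℝ, 1 ≤ β →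
      ∀ A : Finset Polymer, (∀ γ ∈ A, γ.k = 0) →
        Set.InjOn (fun γ : Polymer => (γ.k, Torus.proj (2 * L + 1) (anchor 𝔟 γ), γ.μ, γ.ν)) ↑A →
        torusE (Matrix.specialUnitaryGroup (Fin N) ℂ) (fundamentalLatticeRep N) β L (fun U => ∏ γ ∈ A,
          (largeFieldEvent (N := N) 𝔟 ε₀ γ).indicator (fun _ => (1 : ℝ)) U) ≤
          ∏ _γ ∈ A, Real.exp (-(β * ((N : ℝ) * ε₀)) / Fintype.card (Orient 4) +
            (K₀ + D₁ * Real.log β) / Fintype.card (Orient 4)) := by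
  classical
  obtain ⟨K₀, D₁, h⟩ := productLaw_largePlaquettes (G := Matrix.specialUnitaryGroup (Fin N) ℂ) (fundamentalLatticeRep N)
  refine ⟨K₀, D₁, ?_⟩
  intro 𝔟 ε₀ L hL β hβ A hA0 hinj
  haveI := isProbabilityMeasure_wilsonMeasure (d := 4) (L := 2 * L + 1) (fundamentalLatticeRep N).ρ
    (fundamentalLatticeRep N).continuous β
  -- the projection to torus plaquettes is injective on a period-free level-0 family
  set π : Polymer → Plaquette 4 (2 * L + 1) := fun γ => (Torus.proj (2 * L + 1) γ.y, ⟨(γ.μ, γ.ν), γ.hμν⟩) with hπ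
  have hπinj : Set.InjOn π ↑A := by
    intro γ hγ γ' hγ' hγγ'
    refine hinj hγ hγ' ?_
    have hk : γ.k = 0 := hA0 γ hγ
    have hk' : γ'.k = 0 := hA0 γ' hγ'
    obtain ⟨k, y, μ, ν, hμν⟩ := γ
    obtain ⟨k', y', μ', ν', hμν'⟩ := γ'
    simp only at hk hk'
    subst hk hk'
    simp only [hπ, Prod.mk.injEq, Subtype.mk.injEq] at hγγ'
    obtain ⟨hy, rfl, rfl⟩ := hγγ'
    simp only [anchor_zero, hy]
  -- read the events on the torus and reindex over the projected plaquettes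
  set F : Plaquette 4 (2 * L + 1) → Set (GaugeConfig 4 (2 * L + 1) (Matrix.specialUnitaryGroup (Fin N) ℂ)) := fun p =>
    {V | (N : ℝ) * ε₀ ≤ plaquetteCost (fundamentalLatticeRep N).ρ V p} with hF
  have hFm : ∀ p, MeasurableSet (F p) := fun p =>
    measurableSet_le measurable_const (measurable_plaquetteCost (fundamentalLatticeRep N).ρ (fundamentalLatticeRep N).continuous p)
  have hread : ∀ V : GaugeConfig 4 (2 * L + 1) (Matrix.specialUnitaryGroup (Fin N) ℂ),
      (∏ γ ∈ A, (largeFieldEvent (N := N) 𝔟 ε₀ γ).indicator (fun _ => (1 : ℝ)) (torusLift (2 * L + 1) V)) =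
        ∏ p ∈ A.image π, (F p).indicator (fun _ => (1 : ℝ)) V := by
    intro V
    rw [Finset.prod_image hπinj]
    exact Finset.prod_congr rfl fun γ hγ => indicator_largeFieldEvent_levelZero_torusLift (N := N) 𝔟 ε₀ L (hA0 γ hγ) V
  have hodd : Odd (2 * L + 1) := odd_two_mul_add_one L
  show ∫ V, (∏ γ ∈ A, (largeFieldEvent (N := N) 𝔟 ε₀ γ).indicator (fun _ => (1 : ℝ)) (torusLift (2 * L + 1) V))
      ∂(wilsonMeasure (d := 4) (L := 2 * L + 1) (fundamentalLatticeRep N).ρ β) ≤ _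
  simp_rw [hread]
  rw [integral_prod_indicator_eq_measureReal _ (A.image π) F hFm, Finset.prod_const, ← Finset.card_image_of_injOn hπinj,
    ← Finset.prod_const]
  have h1 := h hodd (by omega) β hβ ((N : ℝ) * ε₀) (A.image π)
  have hset : (⋂ p ∈ A.image π, F p) =
      ⋂ p ∈ A.image π, {V : GaugeConfig 4 (2 * L + 1) (Matrix.specialUnitaryGroup (Fin N) ℂ) |
        (N : ℝ) * ε₀ ≤ plaquetteCost (fundamentalLatticeRep N).ρ V p} := rfl
  rw [hset]
  exact h1

end LevelZero

end Summit.QuantumFields.YangMills.Cruxes.UVSeamRec.TemperedResponse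

end
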